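import Summits.QuantumFields.BalabanUV.Beta.FP.TorusCompositeInsertionKernelSingleSym
import Summits.QuantumFields.BalabanUV.Beta.FP.CompositeBorderTables
import Summits.QuantumFields.BalabanUV.Beta.FP.TorusCompositeInsertionKernelPacked

/-!
# `BalabanUV.Beta.FP.TorusCompositeInsertionKernelPackedSym` — road «FP» for binder row D1, ROUTE T, (β1) «sym» column: **THE THREE SYM KERNEL JUNCTIONS AT PACKED BORDER
# FAMILIES** (the (β1) twin of `TorusCompositeInsertionKernelPacked`, proofs line for line) — the `-Sym` door's (S3-2) Q-sockets for a family `𝒱 κ′ u := cu • packVH K (Lc^n) κ′ u` (an1's packer of a border kernel at the tower's blocking; an2 F3's `compVhS … := packVH (compVHKer …) (L^m)`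
# shape) whose kernel functional IS the functional of our chain rule: the kernel clauses `h𝒱 ∕ h𝒲` and the windows `hS ∕ hT ∕ hT′` of R-9∕R-10 DISCHARGED from the
# packer's entries (`packVH_inr_inl`, `off_zsmul`, `blk_zsmul`) and the kernel's windows — so the sym F4 ∕ F5's torus face is ONE application per order

WHY.  `sum_mul_perZ_dper_eq_compIns₁Sym_apply` (order 1) and `sum_sum_mul_tsum₂_eq_compIns₂₂Sym_apply` ∕ the single-bond-pair file (order 2) take an abstract `MKer` family with a
kernel clause (`h𝒱 ∕ h𝒲`: its `(inr κ, inl l)` border entries at the coarse multiplier sites pair to the functional) and windows.  The row's families ARE packers: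
`packVH K N κ′ u` has `(inr μ, inl α)` entry `[off N x = 0] · K μ (blk N x) (α, z) (κ′, u)` (an1 `AveragingHessianKernels` :1148), so at `x = N • x̄` the entry is the
border kernel itself; «the functional IS the kernel functional» is the row's DEFINITION of `𝓘₁ ∕ 𝓘₂` (R-13's shape (a), sym bricks).  THIS FILE:
§1 `sum_mul_perZ_dper_packVH_eq_compIns₁Sym_apply` — the order-1 sym junction for `𝒱 := cu • packVH K (Lc^n)` under: the clauses `h0 ∕ hsucc`, the kernel-functional identity `h𝓘` at depth
`n` with unit `cu`, the kernel's windows `hKz ∕ hKu` (indexed by the COARSE site), the packed family's block covariance `hVt` (an2 F3 `compVhS_translate`'s shape);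
+ `perZ_dper_packVH_eq_compIns₁Sym_apply_single` (one lattice-labelled bond, every box).  §2 the ORDER-2 twins for `𝒲 κ u κ′ u′ := cu • packVH (fun μ y f f′ => K₂ μ y f
(κ,u) f′) (Lc^n) κ′ u′` (an2 F5's `compVh2S` shape): the all-pairs identity, and the socket form under the `K₀` guard (`…_of_diam`).  [folklore] BY NAME; no `def`,
nothing cited, 0 sorry; NO chart; the kernels `K ∕ K₂`, units, windows and functionals are HYPOTHESES (the row's); nothing of Bałaban's asserted.

HONEST DEPENDENCY (page 1, mandatory): continuum YM on T⁴ ⇐ BetaPertH ∧ nine spine estimates (0/9 proved); BetaPertH ⇐ (D1) ∧ (D4) ∧ CAP+tail;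
G-an2-4 gates asym, D1 and NE2/3/4.  HONEST FRAMING (cell contract, verbatim): «discharging `BetaPertH` makes Bałaban's UV stability UNCONDITIONAL —
a real constructive-QFT result; it is NOT the continuum limit and NOT the Clay problem.»  ABSOLUTE RULE (cell charter, verbatim): «No internally-minted
statement may enter as a cited fact. Every hypothesis is either kernel-proved in this package or a verbatim quotation of a PUBLISHED theorem with page
reference. The manuscript(s) under audit are NOT citable for their own disputed steps — they are the thing under adjudication; programme-internal
(2001/route/tribunal) claims are never citable.»  0 estimates; 0∕4 row-D1 binders (hW, hR, D1Tel, D1Rep); NOT (T-ID), NOT (C1), NOT SDF, NOT D1,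
NOT BetaPertH, NOT continuum, NOT Clay.  D1 formalisation swarm LEAF PROVER 02 (b2b-balaban-beta-d1-formalise-leaf-02 gen 32), 2026-08-24.  No existing file touched.
v1.1 (leaf-02 g33, 2026-08-25): the two `packVH` letters `smul_packVH_zsmul_inr_inl ∕ smul_packVH_inr_inl_eq_zero` are READ BY NAME from the rooted R-14 `TorusCompositeInsertionKernelPacked` instead of re-typed (`dedup.landed` is α-invariant); the other declarations byte-identical to v1 c96c6a9b711f3395.
-/

noncomputable section

open scoped BigOperators

namespace Summit.QuantumFields.BalabanUV.Beta.FP.TorusCompositeInsertionKernelPackedSym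

open Matrix Finset
open Literature.MathematicalPhysics.QuantumFieldTheory
open Literature.MathematicalPhysics.QuantumFieldTheory.Balaban1983to89
open Literature.MathematicalPhysics.QuantumFieldTheory.Balaban1983to89.Beta
open B5Prop11Plancherel (fine)
open B6Lemma24Torus (pbox)
open B4TorusKernel.MultiPeriod (translate)
open ExpKernelCalculus (MKer shiftK)
open AffineAveraging (Site Form1 box toSite)
open AveragingContours (off blk)
open AveragingContoursRooted (ctr ctrOff)
open AveragingHessianKernels (Bond packVH packVH_inr_inl)
open Summit.QuantumFields.BalabanUV.Beta.SymAveragingHessianCounts (symVhKerAt symLinKerAt)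
open Summit.QuantumFields.BalabanUV.Beta.SymAveragingMixedJetTables (symVh2KerAt)
open OneStepResolventKernel (Fib)
open Summit.QuantumFields.BalabanUV.Beta.BorderedHessian (stepScale)
open Summit.QuantumFields.BalabanUV.Beta.FP.KernelPeriodisationFib (perZ)
open Summit.QuantumFields.BalabanUV.Beta.FP.KernelPeriodisationFibLoc (dper)
open Summit.QuantumFields.BalabanUV.Beta.FP.CompositeBorderTables (off_zsmul blk_zsmul)
open Summit.QuantumFields.BalabanUV.Beta.FP.TorusGaugeCovariancePairing (wrapPt)
open Summit.QuantumFields.BalabanUV.Beta.FP.TorusCompositeObjects (towerTorus)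
open Summit.QuantumFields.BalabanUV.Beta.FP.TorusCompositeCovarianceOneSym (compIns₁Sym)
open Summit.QuantumFields.BalabanUV.Beta.FP.TorusCompositeCovarianceTwoPolarSym (compIns₂₂Sym)
open Summit.QuantumFields.BalabanUV.Beta.FP.TorusCompositeInsertionKernelSym (sum_mul_perZ_dper_eq_compIns₁Sym_apply)
open Summit.QuantumFields.BalabanUV.Beta.FP.TorusCompositeInsertionKernelTwoSym (sum_sum_mul_tsum₂_eq_compIns₂₂Sym_apply)
open Summit.QuantumFields.BalabanUV.Beta.FP.TorusCompositeInsertionKernelSingleSym (perZ_dper_eq_compIns₁Sym_apply_single perZ_dper_eq_compIns₂₂Sym_apply_single_of_diam)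
open Summit.QuantumFields.BalabanUV.Beta.FP.TorusCompositeInsertionKernelPacked (smul_packVH_zsmul_inr_inl smul_packVH_inr_inl_eq_zero)

variable {d : ℕ} (Lc : ℕ) [NeZero Lc]

/-! ## §1 Order 1: R-9 at a packed border family -/

section OrderOne

variable (hc : ctrOff (d + 1) Lc ∈ box (d + 1) Lc)
    (𝓡 : (ℕ → ℕ) → ℕ → Form1 (d + 1) ℝ → Form1 (d + 1) ℝ)
    (hR0 : ∀ (lev : ℕ → ℕ) (B : Form1 (d + 1) ℝ), 𝓡 lev 0 B = B)
    (hRsucc : ∀ (lev : ℕ → ℕ) (n : ℕ) (B : Form1 (d + 1) ℝ) (κ : Fin (d + 1)) (x : Site (d + 1)),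
      𝓡 lev (n + 1) B κ x = stepScale d Lc (lev 1) * ((Lc : ℝ) ^ (d + 1)
        * ∑' z : Site (d + 1), ∑ l : Fin (d + 1), symLinKerAt (ctr (d + 1) Lc) Lc κ x (l, z) * 𝓡 (fun k => lev (k + 1)) n B l z))
    (𝓘 : (ℕ → ℕ) → ℕ → Form1 (d + 1) ℝ → Form1 (d + 1) ℝ → Form1 (d + 1) ℝ)
    (h0 : ∀ (lev : ℕ → ℕ) (H B : Form1 (d + 1) ℝ), 𝓘 lev 0 H B = 0)
    (hsucc : ∀ (lev : ℕ → ℕ) (n : ℕ) (H B : Form1 (d + 1) ℝ) (κ : Fin (d + 1)) (x : Site (d + 1)),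
      𝓘 lev (n + 1) H B κ x
        = (((Lc : ℝ) ^ (d + 1) * stepScale d Lc (lev 1)) * (∏ i ∈ Finset.range n, (stepScale d Lc (lev (i + 1 + 1)) * ((box (d + 1) Lc).card : ℝ)))⁻¹) *
            (∑' u : Site (d + 1), ∑ κ' : Fin (d + 1),
              (∑' z : Site (d + 1), ∑ l : Fin (d + 1), symVhKerAt (ctr (d + 1) Lc) Lc κ x (l, z) (κ', u) * 𝓡 (fun k => lev (k + 1)) n B l z) *
                𝓡 (fun k => lev (k + 1)) n H κ' u)
          + stepScale d Lc (lev 1) * ((Lc : ℝ) ^ (d + 1) *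
              ∑' z : Site (d + 1), ∑ l : Fin (d + 1), symLinKerAt (ctr (d + 1) Lc) Lc κ x (l, z) * 𝓘 (fun k => lev (k + 1)) n H B l z))
    (n : ℕ) (M : Fin (d + 1) → ℕ) [∀ μ, NeZero (M μ)] (lev : ℕ → ℕ) (rs : ℕ → (Fin (d + 1) → ℕ))
    (K : Fin (d + 1) → Site (d + 1) → Bond (d + 1) → Bond (d + 1) → ℝ) (cu : ℝ) (WK : Site (d + 1) → Finset (Site (d + 1)))
    (hKz : ∀ (μ : Fin (d + 1)) (x : Site (d + 1)) (α κ' : Fin (d + 1)) (u : Site (d + 1)), ∀ z ∉ WK x, K μ x (α, z) (κ', u) = 0)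
    (hKu : ∀ (μ : Fin (d + 1)) (x : Site (d + 1)) (α : Fin (d + 1)) (z : Site (d + 1)) (κ' : Fin (d + 1)), ∀ u ∉ WK x, K μ x (α, z) (κ', u) = 0)
    (hVt : ∀ (κ' : Fin (d + 1)) (u t : Site (d + 1)), packVH K (Lc ^ n) κ' (u + (((Lc ^ n : ℕ) : ℤ)) • t) = shiftK (-((((Lc ^ n : ℕ) : ℤ)) • t)) (packVH K (Lc ^ n) κ' u))
    (h𝓘 : ∀ (H B : Form1 (d + 1) ℝ) (κ : Fin (d + 1)) (x : Site (d + 1)), 𝓘 lev n H B κ x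
      = cu * ∑' u : Site (d + 1), ∑ κ' : Fin (d + 1), (∑' z : Site (d + 1), ∑ l : Fin (d + 1), K κ x (l, z) (κ', u) * B l z) * H κ' u)

include hc hR0 hRsucc h0 hsucc hKz hKu hVt h𝓘

/-- [folklore] **THE ORDER-1 SYM KERNEL JUNCTION AT A PACKED BORDER FAMILY** — for `𝒱 κ′ u := cu • packVH K (Lc^n) κ′ u` with the kernel-functional identity `h𝓘` at depth `n` (the row's naming of
`𝓘₁`, unit `cu`), the kernel's windows `hKz ∕ hKu` and the packed family's block covariance `hVt`:
`Σ_b h b · perZ T (dper T (cu • packVH K (Lc^n) b.2 b.1)) (Lc^n • x̄) z (inr κ) (inl β) = compIns₁Sym Lc M lev rs n h (x̄, κ) (z, β)`. -/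
theorem sum_mul_perZ_dper_packVH_eq_compIns₁Sym_apply
    (h : ↥(pbox (towerTorus Lc M n)) × Fin (d + 1) → ℝ) (x : ↥(pbox M)) (κ : Fin (d + 1)) (z : ↥(pbox (towerTorus Lc M n))) (β : Fin (d + 1)) :
    ∑ b : ↥(pbox (towerTorus Lc M n)) × Fin (d + 1), h b *
        perZ (towerTorus Lc M n) (dper (towerTorus Lc M n) (cu • packVH K (Lc ^ n) b.2 (b.1 : Site (d + 1)))) ((((Lc ^ n : ℕ) : ℤ)) • (x : Site (d + 1))) (z : Site (d + 1))
          (Sum.inr κ) (Sum.inl β)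
      = compIns₁Sym Lc M lev rs n h (x, κ) (z, β) := by
  have hN : 1 ≤ Lc ^ n := Nat.one_le_iff_ne_zero.mpr (pow_ne_zero _ (NeZero.ne Lc))
  refine sum_mul_perZ_dper_eq_compIns₁Sym_apply Lc hc 𝓡 hR0 hRsucc 𝓘 h0 hsucc n M lev rs (fun κ' u => cu • packVH K (Lc ^ n) κ' u) (fun X => WK (blk (Lc ^ n) X))
    (fun κ' u t => ?_) (fun κ' u X μ α z hz => smul_packVH_inr_inl_eq_zero _ K cu κ' u X z μ α (hKz μ _ α κ' u z hz))
    (fun κ' X z μ α u hu => smul_packVH_inr_inl_eq_zero _ K cu κ' u X z μ α (hKu μ _ α z κ' u hu)) (fun H B κ x => ?_) h x κ z β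
  · show cu • packVH K (Lc ^ n) κ' (u + (((Lc ^ n : ℕ) : ℤ)) • t) = shiftK (-((((Lc ^ n : ℕ) : ℤ)) • t)) (cu • packVH K (Lc ^ n) κ' u)
    rw [hVt]
    rfl
  · rw [h𝓘, ← tsum_mul_left]
    exact tsum_congr fun u => by
      rw [Finset.mul_sum]
      refine Finset.sum_congr rfl fun κ' _ => ?_
      rw [← mul_assoc, ← tsum_mul_left]
      refine congrArg (fun t : ℝ => t * _) (tsum_congr fun z => ?_)
      rw [Finset.mul_sum]
      exact Finset.sum_congr rfl fun l _ => by rw [smul_packVH_zsmul_inr_inl hN, mul_assoc]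

/-- [folklore] the same AT ONE LATTICE-LABELLED BOND, every box (the single-bond file at the packed family): `perZ T (dper T (cu • packVH K (Lc^n) κ′ u)) (Lc^n • x̄) z (inr κ) (inl β)
= compIns₁Sym Lc M lev rs n δ_{(wrapPt T u, κ′)} (x̄, κ) (z, β)` — #41d ∕ #42a's `hQF₁ ∕ hQF₁′` (and, one storey up via R-12, `hQN₁ ∕ hQN₁′`'s undressed summand). -/
theorem perZ_dper_packVH_eq_compIns₁Sym_apply_single
    (κ' : Fin (d + 1)) (u : Site (d + 1)) (x : ↥(pbox M)) (κ : Fin (d + 1)) (z : ↥(pbox (towerTorus Lc M n))) (β : Fin (d + 1)) :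
    perZ (towerTorus Lc M n) (dper (towerTorus Lc M n) (cu • packVH K (Lc ^ n) κ' u)) ((((Lc ^ n : ℕ) : ℤ)) • (x : Site (d + 1))) (z : Site (d + 1)) (Sum.inr κ) (Sum.inl β)
      = compIns₁Sym Lc M lev rs n (fun b => if b = (wrapPt (towerTorus Lc M n) u, κ') then 1 else 0) (x, κ) (z, β) := by
  have hN : 1 ≤ Lc ^ n := Nat.one_le_iff_ne_zero.mpr (pow_ne_zero _ (NeZero.ne Lc))
  refine perZ_dper_eq_compIns₁Sym_apply_single Lc hc 𝓡 hR0 hRsucc 𝓘 h0 hsucc n M lev rs (fun κ' u => cu • packVH K (Lc ^ n) κ' u) (fun X => WK (blk (Lc ^ n) X))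
    (fun κ' u t => ?_) (fun κ' u X μ α z hz => smul_packVH_inr_inl_eq_zero _ K cu κ' u X z μ α (hKz μ _ α κ' u z hz))
    (fun κ' X z μ α u hu => smul_packVH_inr_inl_eq_zero _ K cu κ' u X z μ α (hKu μ _ α z κ' u hu)) (fun H B κ x => ?_) κ' u x κ z β
  · show cu • packVH K (Lc ^ n) κ' (u + (((Lc ^ n : ℕ) : ℤ)) • t) = shiftK (-((((Lc ^ n : ℕ) : ℤ)) • t)) (cu • packVH K (Lc ^ n) κ' u)
    rw [hVt]
    rfl
  · rw [h𝓘, ← tsum_mul_left]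
    exact tsum_congr fun u => by
      rw [Finset.mul_sum]
      refine Finset.sum_congr rfl fun κ' _ => ?_
      rw [← mul_assoc, ← tsum_mul_left]
      refine congrArg (fun t : ℝ => t * _) (tsum_congr fun z => ?_)
      rw [Finset.mul_sum]
      exact Finset.sum_congr rfl fun l _ => by rw [smul_packVH_zsmul_inr_inl hN, mul_assoc]

end OrderOne

/-! ## §2 Order 2: R-10 ∕ R-11 at a packed two-bond border family -/

section OrderTwo

variable (hc : ctrOff (d + 1) Lc ∈ box (d + 1) Lc)
    (𝓡 : (ℕ → ℕ) → ℕ → Form1 (d + 1) ℝ → Form1 (d + 1) ℝ)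
    (hR0 : ∀ (lev : ℕ → ℕ) (B : Form1 (d + 1) ℝ), 𝓡 lev 0 B = B)
    (hRsucc : ∀ (lev : ℕ → ℕ) (n : ℕ) (B : Form1 (d + 1) ℝ) (κ : Fin (d + 1)) (x : Site (d + 1)),
      𝓡 lev (n + 1) B κ x = stepScale d Lc (lev 1) * ((Lc : ℝ) ^ (d + 1)
        * ∑' z : Site (d + 1), ∑ l : Fin (d + 1), symLinKerAt (ctr (d + 1) Lc) Lc κ x (l, z) * 𝓡 (fun k => lev (k + 1)) n B l z))
    (𝓘₁ : (ℕ → ℕ) → ℕ → Form1 (d + 1) ℝ → Form1 (d + 1) ℝ → Form1 (d + 1) ℝ)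
    (h0₁ : ∀ (lev : ℕ → ℕ) (H B : Form1 (d + 1) ℝ), 𝓘₁ lev 0 H B = 0)
    (hsucc₁ : ∀ (lev : ℕ → ℕ) (n : ℕ) (H B : Form1 (d + 1) ℝ) (κ : Fin (d + 1)) (x : Site (d + 1)),
      𝓘₁ lev (n + 1) H B κ x
        = (((Lc : ℝ) ^ (d + 1) * stepScale d Lc (lev 1)) * (∏ i ∈ Finset.range n, (stepScale d Lc (lev (i + 1 + 1)) * ((box (d + 1) Lc).card : ℝ)))⁻¹) *
            (∑' u : Site (d + 1), ∑ κ' : Fin (d + 1),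
              (∑' z : Site (d + 1), ∑ l : Fin (d + 1), symVhKerAt (ctr (d + 1) Lc) Lc κ x (l, z) (κ', u) * 𝓡 (fun k => lev (k + 1)) n B l z) *
                𝓡 (fun k => lev (k + 1)) n H κ' u)
          + stepScale d Lc (lev 1) * ((Lc : ℝ) ^ (d + 1) *
              ∑' z : Site (d + 1), ∑ l : Fin (d + 1), symLinKerAt (ctr (d + 1) Lc) Lc κ x (l, z) * 𝓘₁ (fun k => lev (k + 1)) n H B l z))
    (𝓘₂ : (ℕ → ℕ) → ℕ → Form1 (d + 1) ℝ → Form1 (d + 1) ℝ → Form1 (d + 1) ℝ → Form1 (d + 1) ℝ)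
    (h0₂ : ∀ (lev : ℕ → ℕ) (H H' B : Form1 (d + 1) ℝ), 𝓘₂ lev 0 H H' B = 0)
    (hsucc₂ : ∀ (lev : ℕ → ℕ) (n : ℕ) (H H' B : Form1 (d + 1) ℝ) (κ₀ : Fin (d + 1)) (x : Site (d + 1)),
      𝓘₂ lev (n + 1) H H' B κ₀ x
        = ((((Lc : ℝ) ^ (d + 1) * stepScale d Lc (lev 1)) * (∏ i ∈ Finset.range n, (stepScale d Lc (lev (i + 1 + 1)) * ((box (d + 1) Lc).card : ℝ)))⁻¹)
            * (∏ i ∈ Finset.range n, (stepScale d Lc (lev (i + 1 + 1)) * ((box (d + 1) Lc).card : ℝ)))⁻¹) *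
            (∑' u : Site (d + 1), ∑ κ : Fin (d + 1), (∑' u' : Site (d + 1), ∑ κ' : Fin (d + 1),
              (∑' z : Site (d + 1), ∑ l : Fin (d + 1),
                (1 / 2 : ℝ) * (symVh2KerAt (ctr (d + 1) Lc) Lc κ₀ x (l, z) (κ, u) (κ', u') + symVh2KerAt (ctr (d + 1) Lc) Lc κ₀ x (l, z) (κ', u') (κ, u)) *
                  𝓡 (fun k => lev (k + 1)) n B l z) *
              𝓡 (fun k => lev (k + 1)) n H' κ' u') * 𝓡 (fun k => lev (k + 1)) n H κ u)
          + (((Lc : ℝ) ^ (d + 1) * stepScale d Lc (lev 1)) * (∏ i ∈ Finset.range n, (stepScale d Lc (lev (i + 1 + 1)) * ((box (d + 1) Lc).card : ℝ)))⁻¹) *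
            ((∑' u : Site (d + 1), ∑ κ' : Fin (d + 1),
              (∑' z : Site (d + 1), ∑ l : Fin (d + 1), symVhKerAt (ctr (d + 1) Lc) Lc κ₀ x (l, z) (κ', u) * 𝓘₁ (fun k => lev (k + 1)) n H' B l z) *
                𝓡 (fun k => lev (k + 1)) n H κ' u)
            + (∑' u : Site (d + 1), ∑ κ' : Fin (d + 1),
              (∑' z : Site (d + 1), ∑ l : Fin (d + 1), symVhKerAt (ctr (d + 1) Lc) Lc κ₀ x (l, z) (κ', u) * 𝓘₁ (fun k => lev (k + 1)) n H B l z) *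
                𝓡 (fun k => lev (k + 1)) n H' κ' u))
          + stepScale d Lc (lev 1) * ((Lc : ℝ) ^ (d + 1) *
              ∑' z : Site (d + 1), ∑ l : Fin (d + 1), symLinKerAt (ctr (d + 1) Lc) Lc κ₀ x (l, z) * 𝓘₂ (fun k => lev (k + 1)) n H H' B l z))
    (n : ℕ) (M : Fin (d + 1) → ℕ) [∀ μ, NeZero (M μ)] (lev : ℕ → ℕ) (rs : ℕ → (Fin (d + 1) → ℕ))
    (K₂ : Fin (d + 1) → Site (d + 1) → Bond (d + 1) → Bond (d + 1) → Bond (d + 1) → ℝ) (cu : ℝ) (WK : Site (d + 1) → Finset (Site (d + 1)))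
    (hK2z : ∀ (μ : Fin (d + 1)) (x : Site (d + 1)) (α : Fin (d + 1)) (f₁ f₂ : Bond (d + 1)), ∀ z ∉ WK x, K₂ μ x (α, z) f₁ f₂ = 0)
    (hK2u : ∀ (μ : Fin (d + 1)) (x : Site (d + 1)) (f : Bond (d + 1)) (κ : Fin (d + 1)) (f₂ : Bond (d + 1)), ∀ u ∉ WK x, K₂ μ x f (κ, u) f₂ = 0)
    (hK2u' : ∀ (μ : Fin (d + 1)) (x : Site (d + 1)) (f f₁ : Bond (d + 1)) (κ' : Fin (d + 1)), ∀ u' ∉ WK x, K₂ μ x f f₁ (κ', u') = 0)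
    (hWt : ∀ (κ : Fin (d + 1)) (u : Site (d + 1)) (κ' : Fin (d + 1)) (u' t : Site (d + 1)),
      packVH (fun μ y f f' => K₂ μ y f (κ, u + (((Lc ^ n : ℕ) : ℤ)) • t) f') (Lc ^ n) κ' (u' + (((Lc ^ n : ℕ) : ℤ)) • t)
        = shiftK (-((((Lc ^ n : ℕ) : ℤ)) • t)) (packVH (fun μ y f f' => K₂ μ y f (κ, u) f') (Lc ^ n) κ' u'))
    (h𝓘₂ : ∀ (H H' B : Form1 (d + 1) ℝ) (κ₀ : Fin (d + 1)) (x : Site (d + 1)), 𝓘₂ lev n H H' B κ₀ x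
      = cu * ∑' u : Site (d + 1), ∑ κ : Fin (d + 1), (∑' u' : Site (d + 1), ∑ κ' : Fin (d + 1),
          (∑' z : Site (d + 1), ∑ l : Fin (d + 1), K₂ κ₀ x (l, z) (κ, u) (κ', u') * B l z) * H' κ' u') * H κ u)

include hc hR0 hRsucc h0₁ hsucc₁ h0₂ hsucc₂ hK2z hK2u hK2u' hWt h𝓘₂

omit hWt in
/-- [folklore] **THE ORDER-2 SYM KERNEL JUNCTION AT A PACKED TWO-BOND BORDER FAMILY** — for `𝒲 κ u κ′ u′ := cu • packVH (fun μ y f f′ => K₂ μ y f (κ,u) f′) (Lc^n) κ′ u′` (an2 F5's `compVh2S`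
shape: an1's packer closed over the first background bond) with the bi-kernel-functional identity `h𝓘₂` (unit `cu`), the kernel's windows in its three fine slots and the
packed family windowed (`hWt` is not needed here): ALL pairs of copies load — exact at every box. -/
theorem sum_sum_mul_tsum₂_packVH_eq_compIns₂₂Sym_apply
    (h h' : ↥(pbox (towerTorus Lc M n)) × Fin (d + 1) → ℝ) (x : ↥(pbox M)) (κ₀ : Fin (d + 1)) (z : ↥(pbox (towerTorus Lc M n))) (β : Fin (d + 1)) :
    ∑ b : ↥(pbox (towerTorus Lc M n)) × Fin (d + 1), ∑ b' : ↥(pbox (towerTorus Lc M n)) × Fin (d + 1), h b * (h' b' *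
        ∑' m₁ : Site (d + 1), ∑' m₂ : Site (d + 1), ∑' m : Site (d + 1),
          (cu • packVH (fun μ y f f' => K₂ μ y f (b.2, translate (towerTorus Lc M n) (b.1 : Site (d + 1)) m₁) f') (Lc ^ n) b'.2
              (translate (towerTorus Lc M n) (b'.1 : Site (d + 1)) m₂))
            ((((Lc ^ n : ℕ) : ℤ)) • (x : Site (d + 1))) (translate (towerTorus Lc M n) (z : Site (d + 1)) m) (Sum.inr κ₀) (Sum.inl β))
      = compIns₂₂Sym Lc M lev rs n h h' (x, κ₀) (z, β) := by
  have hN : 1 ≤ Lc ^ n := Nat.one_le_iff_ne_zero.mpr (pow_ne_zero _ (NeZero.ne Lc))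
  refine sum_sum_mul_tsum₂_eq_compIns₂₂Sym_apply Lc hc 𝓡 hR0 hRsucc 𝓘₁ h0₁ hsucc₁ 𝓘₂ h0₂ hsucc₂ n M lev rs
    (fun κ u κ' u' => cu • packVH (fun μ y f f' => K₂ μ y f (κ, u) f') (Lc ^ n) κ' u') (fun X => WK (blk (Lc ^ n) X))
    (fun κ u κ' u' X μ α z hz => smul_packVH_inr_inl_eq_zero _ _ cu κ' u' X z μ α (hK2z μ _ α _ _ z hz))
    (fun κ κ' u' X z μ α u hu => smul_packVH_inr_inl_eq_zero _ _ cu κ' u' X z μ α (hK2u μ _ _ κ _ u hu))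
    (fun κ u κ' X z μ α u' hu' => smul_packVH_inr_inl_eq_zero _ _ cu κ' u' X z μ α (hK2u' μ _ _ _ κ' u' hu')) (fun H H' B κ₀ x => ?_) h h' x κ₀ z β
  rw [h𝓘₂, ← tsum_mul_left]
  refine tsum_congr fun u => ?_
  rw [Finset.mul_sum]
  refine Finset.sum_congr rfl fun κ _ => ?_
  rw [← mul_assoc, ← tsum_mul_left]
  refine congrArg (fun t : ℝ => t * _) (tsum_congr fun u' => ?_)
  rw [Finset.mul_sum]
  refine Finset.sum_congr rfl fun κ' _ => ?_
  rw [← mul_assoc, ← tsum_mul_left]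
  refine congrArg (fun t : ℝ => t * _) (tsum_congr fun z => ?_)
  rw [Finset.mul_sum]
  exact Finset.sum_congr rfl fun l _ => by rw [smul_packVH_zsmul_inr_inl hN, mul_assoc]

/-- [folklore] **THE ORDER-2 SOCKET AT A PACKED TWO-BOND BORDER FAMILY, UNDER THE `K₀` GUARD** (`…Sym_apply_single_of_diam` at the packed family): with the kernel's window at the
coarse site `x̄` of `ℓ^∞`-diameter `≤ D` and `D + |u i − u′ i| < T i` in every direction,
`perZ T (dper T (cu • packVH (fun μ y f f′ => K₂ μ y f (κ,u) f′) (Lc^n) κ′ u′)) (Lc^n • x̄) z (inr κ₀) (inl β) = compIns₂₂Sym Lc M lev rs n δ_{(wrapPt T u, κ)} δ_{(wrapPt T u′, κ′)} (x̄, κ₀) (z, β)`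
— #41d ∕ #42a's `hQF₂` (and via R-12 `hQN₂`'s undressed summand) at the row's packed family, for boxes beyond `K₀`. -/
theorem perZ_dper_packVH_eq_compIns₂₂Sym_apply_single_of_diam
    (κ : Fin (d + 1)) (u : Site (d + 1)) (κ' : Fin (d + 1)) (u' : Site (d + 1))
    (x : ↥(pbox M)) (κ₀ : Fin (d + 1)) (z : ↥(pbox (towerTorus Lc M n))) (β : Fin (d + 1)) (D : ℤ)
    (hD : ∀ v ∈ WK (x : Site (d + 1)), ∀ v' ∈ WK (x : Site (d + 1)), ∀ i : Fin (d + 1), |v i - v' i| ≤ D)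
    (hK : ∀ i : Fin (d + 1), D + |u i - u' i| < (towerTorus Lc M n i : ℤ)) :
    perZ (towerTorus Lc M n) (dper (towerTorus Lc M n) (cu • packVH (fun μ y f f' => K₂ μ y f (κ, u) f') (Lc ^ n) κ' u'))
        ((((Lc ^ n : ℕ) : ℤ)) • (x : Site (d + 1))) (z : Site (d + 1)) (Sum.inr κ₀) (Sum.inl β)
      = compIns₂₂Sym Lc M lev rs n (fun b => if b = (wrapPt (towerTorus Lc M n) u, κ) then 1 else 0)
          (fun b => if b = (wrapPt (towerTorus Lc M n) u', κ') then 1 else 0) (x, κ₀) (z, β) := by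
  have hN : 1 ≤ Lc ^ n := Nat.one_le_iff_ne_zero.mpr (pow_ne_zero _ (NeZero.ne Lc))
  have hD' : ∀ v ∈ WK (blk (Lc ^ n) ((((Lc ^ n : ℕ) : ℤ)) • (x : Site (d + 1)))), ∀ v' ∈ WK (blk (Lc ^ n) ((((Lc ^ n : ℕ) : ℤ)) • (x : Site (d + 1)))),
      ∀ i : Fin (d + 1), |v i - v' i| ≤ D := by
    rw [blk_zsmul hN]
    exact hD
  refine perZ_dper_eq_compIns₂₂Sym_apply_single_of_diam Lc hc 𝓡 hR0 hRsucc 𝓘₁ h0₁ hsucc₁ 𝓘₂ h0₂ hsucc₂ n M lev rs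
    (fun κ u κ' u' => cu • packVH (fun μ y f f' => K₂ μ y f (κ, u) f') (Lc ^ n) κ' u') (fun X => WK (blk (Lc ^ n) X))
    (fun κ u κ' u' t => ?_)
    (fun κ u κ' u' X μ α z hz => smul_packVH_inr_inl_eq_zero _ _ cu κ' u' X z μ α (hK2z μ _ α _ _ z hz))
    (fun κ κ' u' X z μ α u hu => smul_packVH_inr_inl_eq_zero _ _ cu κ' u' X z μ α (hK2u μ _ _ κ _ u hu))
    (fun κ u κ' X z μ α u' hu' => smul_packVH_inr_inl_eq_zero _ _ cu κ' u' X z μ α (hK2u' μ _ _ _ κ' u' hu')) (fun H H' B κ₀ x => ?_)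
    κ u κ' u' x κ₀ z β D hD' hK
  · show cu • packVH (fun μ y f f' => K₂ μ y f (κ, u + (((Lc ^ n : ℕ) : ℤ)) • t) f') (Lc ^ n) κ' (u' + (((Lc ^ n : ℕ) : ℤ)) • t)
        = shiftK (-((((Lc ^ n : ℕ) : ℤ)) • t)) (cu • packVH (fun μ y f f' => K₂ μ y f (κ, u) f') (Lc ^ n) κ' u')
    rw [hWt]
    rfl
  · rw [h𝓘₂, ← tsum_mul_left]
    refine tsum_congr fun u => ?_
    rw [Finset.mul_sum]
    refine Finset.sum_congr rfl fun κ _ => ?_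
    rw [← mul_assoc, ← tsum_mul_left]
    refine congrArg (fun t : ℝ => t * _) (tsum_congr fun u' => ?_)
    rw [Finset.mul_sum]
    refine Finset.sum_congr rfl fun κ' _ => ?_
    rw [← mul_assoc, ← tsum_mul_left]
    refine congrArg (fun t : ℝ => t * _) (tsum_congr fun z => ?_)
    rw [Finset.mul_sum]
    exact Finset.sum_congr rfl fun l _ => by rw [smul_packVH_zsmul_inr_inl hN, mul_assoc]

end OrderTwo

end Summit.QuantumFields.BalabanUV.Beta.FP.TorusCompositeInsertionKernelPackedSym

end
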